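import Literature.NumberTheory.IwasawaTheory.ClassicalMuVanishesUnramifiedClassesTower
import Literature.NumberTheory.IwasawaTheory.CyclotomicRatTotallyRamified
import Literature.NumberTheory.IwasawaTheory.ClassicalMuVanishesSubextension
import HarnessLib

/-!
# Along a `ℤ_p`-tower: the number of primes above a totally ramified place in `K̄^V` (`V ≤ Gal(K̄/K_n)` open normal)
# is at most `[Γ_K : V] / pⁿ`, and the class number of `K₀·K_n ⊆ K̄` is the `e_n` of the restricted tower
# (proved; no definition, no named fact)

`Proofs`-style file in topic `NumberTheory/IwasawaTheory` (namespace
`Literature.NumberTheory.IwasawaTheory.CyclotomicTowerPrimesAboveBound`), written by the prover seat `bsd-eis-lam-a` g20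
(cell `bsd-eis`; `--supports` stmt-BirchSwinnertonDyer-19035, crux 5 `MazurMCOnX1RankZero`, registered stub
`stub_publishedL59`; closes nothing).  Two Θ-independent book-keeping lemmas for the tower step of Greenberg, LNM 1716,
Lemma 5.9 (the finitely many primes above `p` of `K_∞`, and the growth of the class numbers along `K₀ℚ_n`):

* §1 `eq_of_natCast_mem` — `𝓞_ℚ` has one prime containing `p`; `inertia_sup_kerSubgroup_eq_top_of_natCast_mem` — `p` is
  totally ramified in `ℚ_∞/ℚ` (`I_𝔓 ⊔ Gal(ℚ̄/ℚ_∞) = Γ_ℚ`, the tree's theorem with `primesEquiv v = p` discharged).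
* §2 **`ncard_primesOver_mul_pow_le_index`** — `κ` a `ℤ_p`-extension of a number field `K`, `v` a place with a prime
  `𝔓` of `\bar ℤ_K` above it such that `I_𝔓 ⊔ Gal(K̄/K_∞) = Γ_K`, `V ≤ Gal(K̄/K_n)` open normal, `L = K̄^V`:
  `#(v.primesOver 𝓞_L) · pⁿ ≤ [Γ_K : V]`.  PROOF: fundamental identity `g·e·f = [L:K]` (Mathlib); the inertia group of
  `Gal(L/K)` at the prime below `𝔓` is the restriction of `I_𝔓` (tree `inertia_comap_ringOfIntegers_eq_map_absRestrictNormalHom`),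
  of order `[I_𝔓 : I_𝔓 ∩ V] ≥ [I_𝔓 : I_𝔓 ∩ Gal(K̄/K_n)] = pⁿ`.  `natCard_primes_mem_le_ncard_primesOver` converts to «primes
  containing `p`» when `K` has one place above `p` (`K = ℚ`).
* §3 **`padicValNat_card_classGroup_eq_classNumberPExp`** — for a subgroup `N ≤ Γ_K` with fixed field `K₀ = K̄^N` on which `κ`
  restricts to a `ℤ_p`-extension: `ord_p #Cl(𝓞 (K₀ ⊔ K_n)) = e_n(κ|_{K₀})` (the layer isomorphism
  `(K₀·K_∞)_n ≃ₐ[K] K₀ ⊔ K_n` of `ClassicalMuVanishesSubextension`, transported to class groups).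

References: [Washington1997] §13.1 (the cyclotomic `ℤ_p`-extension; finitely many primes above `p`); [NeukirchANT1999]
Ch. I §9 (9.4), (9.9); [GreenbergLNM1716] §5 Lemma 5.9 (proof).
-/

set_option autoImplicit false

noncomputable section

open scoped Classical Pointwise NumberField
open NumberField IsDedekindDomain Field IntermediateField

namespace Literature.NumberTheory.IwasawaTheory.CyclotomicTowerPrimesAboveBound

open Literature.NumberTheory.EllipticCurves Literature.NumberTheory.GaloisRepresentations
  Literature.NumberTheory.NumberFields Literature.NumberTheory.IwasawaTheory
  Literature.NumberTheory.IwasawaTheory.ClassicalMuVanishesUnramifiedClasses Rat.HeightOneSpectrum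

variable {K : Type} [Field K] [NumberField K] {p : ℕ} [Fact p.Prime]

/-! ## §1 The prime of `ℚ` above `p` -/

/-- A finite place `w` of `ℚ` containing `p` IS the place `p` under Mathlib's `Rat.HeightOneSpectrum.primesEquiv` (as in
`CyclotomicRatTotallyRamified`, private there; unique factorisation in `ℤ`). [cite: NeukirchANT1999, Ch. I §3 Thm. (3.3)] -/
theorem primesEquiv_eq_of_natCast_mem {w : HeightOneSpectrum (𝓞 ℚ)} (hw : ((p : ℕ) : 𝓞 ℚ) ∈ w.asIdeal) :
    (primesEquiv w : ℕ) = p := by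
  have h1 : natGenerator w ∣ p := by
    rw [natGenerator_dvd_iff, ← map_natCast (Rat.IsIntegralClosure.intEquiv (𝓞 ℚ)) p,
      Ideal.apply_mem_of_equiv_iff]
    exact hw
  exact (Nat.prime_dvd_prime_iff_eq (prime_natGenerator w) Fact.out).mp h1

/-- Two finite places of `ℚ` containing `p` coincide (`𝓞_ℚ = ℤ` has one prime above `p`: unique factorisation).
[cite: NeukirchANT1999, Ch. I §3 Thm. (3.3)] -/
theorem eq_of_natCast_mem {w w' : HeightOneSpectrum (𝓞 ℚ)} (hw : ((p : ℕ) : 𝓞 ℚ) ∈ w.asIdeal)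
    (hw' : ((p : ℕ) : 𝓞 ℚ) ∈ w'.asIdeal) : w = w' :=
  primesEquiv.injective (Subtype.ext ((primesEquiv_eq_of_natCast_mem hw).trans (primesEquiv_eq_of_natCast_mem hw').symm))

/-- **`p` is totally ramified in `ℚ_∞/ℚ`, in the form `I_𝔓 ⊔ Gal(ℚ̄/ℚ_∞) = Γ_ℚ` for every prime `𝔓` of `\bar ℤ` above a
place `v ∋ p`** (the tree's `ZpExtension.IsCyclotomic.inertia_sup_kerSubgroup_eq_top`, with its hypothesis
`primesEquiv v = p` discharged from `p ∈ v`). [cite: Washington1997, §13.1] -/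
theorem inertia_sup_kerSubgroup_eq_top_of_natCast_mem {κ : ZpExtension ℚ p} (hκ : κ.IsCyclotomic)
    {v : HeightOneSpectrum (𝓞 ℚ)} (hv : ((p : ℕ) : 𝓞 ℚ) ∈ v.asIdeal) {𝔓 : Ideal (absIntegers (𝓞 ℚ) ℚ)}
    (h𝔓 : 𝔓 ∈ v.primesAbove) : 𝔓.inertia (absoluteGaloisGroup ℚ) ⊔ κ.kerSubgroup = ⊤ :=
  hκ.inertia_sup_kerSubgroup_eq_top (primesEquiv_eq_of_natCast_mem hv) h𝔓

/-! ## §2 The number of primes above a totally ramified `v` in `K̄^V`, `V ≤ Gal(K̄/K_n)` -/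

/-- **Finitely many primes above a totally ramified place along a `ℤ_p`-tower, quantitatively.**  Let `κ` be a
`ℤ_p`-extension of the number field `K`, `v` a finite place of `K` with a prime `𝔓` of `\bar ℤ_K` above it such that
`I_𝔓 ⊔ Gal(K̄/K_∞) = Γ_K` (`v` totally ramified in `K_∞/K`; e.g. `K = ℚ`, `v = p`, `κ` cyclotomic), `V ≤ Γ_K` an open
normal subgroup contained in `Gal(K̄/K_n)` and `L = K̄^V`.  Then the number of primes of `𝓞_L` above `v`, multiplied by
`pⁿ`, is at most `[Γ_K : V] = [L : K]`: the inertia group of `Gal(L/K)` at the prime below `𝔓` is the restriction of `I_𝔓`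
(tree `inertia_comap_ringOfIntegers_eq_map_absRestrictNormalHom`), of order `[I_𝔓 : I_𝔓 ∩ V] ≥ [I_𝔓 : I_𝔓 ∩ Gal(K̄/K_n)]
= pⁿ`, and `g · e · f = [L : K]` (Mathlib's fundamental identity for Galois extensions).
[cite: Washington1997, §13.1] [cite: NeukirchANT1999, Ch. I §9 (9.9)] -/
theorem ncard_primesOver_mul_pow_le_index (κ : ZpExtension K p)
    (V : Subgroup (absoluteGaloisGroup K)) [hVn : V.Normal] (hV : IsOpen (V : Set (absoluteGaloisGroup K)))
    {n : ℕ} (hVle : V ≤ κ.layerSubgroup n) {v : HeightOneSpectrum (𝓞 K)} {𝔓 : Ideal (absIntegers (𝓞 K) K)}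
    (h𝔓 : 𝔓 ∈ v.primesAbove) (htot : 𝔓.inertia (absoluteGaloisGroup K) ⊔ κ.kerSubgroup = ⊤)
    [NumberField (fixedField V : IntermediateField K (AlgebraicClosure K))] :
    (v.asIdeal.primesOver (𝓞 (fixedField V : IntermediateField K (AlgebraicClosure K)))).ncard * p ^ n ≤
      V.index := by
  have hpr : p.Prime := Fact.out
  haveI : Algebra.IsAlgebraic K (AlgebraicClosure K) := AlgebraicClosure.isAlgebraic K
  haveI : IsGalois K (AlgebraicClosure K) := {}
  set L : IntermediateField K (AlgebraicClosure K) := fixedField V with hLdef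
  have hLV : L.fixingSubgroup = V := fixingSubgroup_fixedField_of_isOpen V hV
  haveI : FiniteDimensional K L := finiteDimensional_fixedField_of_isOpen V hV
  haveI hLgal : IsGalois K L := by
    rw [← InfiniteGalois.normal_iff_isGalois, hLV]; exact hVn
  haveI : Module.Finite (𝓞 K) (𝓞 L) := IsIntegralClosure.finite (𝓞 K) K L (𝓞 L)
  haveI : IsGaloisGroup (L ≃ₐ[K] L) (𝓞 K) (𝓞 L) := IsGaloisGroup.of_isFractionRing (L ≃ₐ[K] L) (𝓞 K) (𝓞 L) K L
  haveI := v.isPrime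
  haveI : 𝔓.IsPrime := h𝔓.1
  set ι := EllipticCurves.ringOfIntegersToIntegralClosure (k := K) (Ω := AlgebraicClosure K) L with hιdef
  set Q : Ideal (𝓞 L) := 𝔓.comap ι with hQdef
  have hQmem := comap_ringOfIntegersToIntegralClosure_mem_primesOver_of_mem_primesAbove L h𝔓
  haveI hQprime : Q.IsPrime := hQmem.1
  haveI : Q.LiesOver v.asIdeal := hQmem.2
  -- the fundamental identity and the inertia group at `Q`
  have hfund := Ideal.ncard_primesOver_mul_ramificationIdxIn_mul_inertiaDegIn v.asIdeal (𝓞 L) (L ≃ₐ[K] L)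
  have he : v.asIdeal.ramificationIdxIn (𝓞 L) = Nat.card (Q.inertia (L ≃ₐ[K] L)) :=
    (Ideal.card_inertia_eq_ramificationIdxIn (G := L ≃ₐ[K] L) v.asIdeal Q).symm
  have hinertia : Q.inertia (L ≃ₐ[K] L) = (𝔓.inertia (absoluteGaloisGroup K)).map (absRestrictNormalHom L) := by
    rw [hQdef]
    exact inertia_comap_ringOfIntegers_eq_map_absRestrictNormalHom L 𝔓
  -- `#I_Q ≥ pⁿ`
  have hker : (absRestrictNormalHom L).ker = V := by
    ext γ
    rw [MonoidHom.mem_ker, absRestrictNormalHom_eq_one_iff, ← hLV]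
    rfl
  have hIcard : p ^ n ≤ Nat.card (Q.inertia (L ≃ₐ[K] L)) := by
    rw [hinertia, ← Subgroup.relIndex_ker, hker]
    have hsup : 𝔓.inertia (absoluteGaloisGroup K) ⊔ κ.layerSubgroup n = ⊤ := by
      rw [eq_top_iff, ← htot]
      exact sup_le_sup_left (κ.kerSubgroup_le_layerSubgroup n) _
    have h1 : (κ.layerSubgroup n).relIndex (𝔓.inertia (absoluteGaloisGroup K)) = p ^ n := by
      rw [← Subgroup.relIndex_sup_right, hsup, Subgroup.relIndex_top_right, ZpExtension.index_layerSubgroup]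
    have hV0 : V.relIndex (𝔓.inertia (absoluteGaloisGroup K)) ≠ 0 := by
      intro h0
      have hdvd := Subgroup.relIndex_dvd_index_of_normal (H := V) (K := 𝔓.inertia (absoluteGaloisGroup K))
      rw [h0, zero_dvd_iff] at hdvd
      haveI : Finite (absoluteGaloisGroup K ⧸ V) := Subgroup.quotient_finite_of_isOpen _ hV
      exact Subgroup.index_ne_zero_of_finite hdvd
    rw [← h1]
    exact Subgroup.relIndex_le_of_le_left hVle hV0
  -- `#G = [L : K] = [Γ : V]`
  have hG : Nat.card (L ≃ₐ[K] L) = V.index := by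
    rw [IsGalois.card_aut_eq_finrank]
    exact finrank_fixedField_of_isOpen V hV
  have hfpos : 0 < v.asIdeal.inertiaDegIn (𝓞 L) := by
    rcases Nat.eq_zero_or_pos (v.asIdeal.inertiaDegIn (𝓞 L)) with h0 | h0
    · rw [h0, mul_zero, mul_zero] at hfund
      exact absurd hfund.symm Nat.card_pos.ne'
    · exact h0
  calc (v.asIdeal.primesOver (𝓞 L)).ncard * p ^ n
      ≤ (v.asIdeal.primesOver (𝓞 L)).ncard * Nat.card (Q.inertia (L ≃ₐ[K] L)) :=
        Nat.mul_le_mul_left _ hIcard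
    _ ≤ (v.asIdeal.primesOver (𝓞 L)).ncard *
          (v.asIdeal.ramificationIdxIn (𝓞 L) * v.asIdeal.inertiaDegIn (𝓞 L)) := by
        rw [he]
        exact Nat.mul_le_mul_left _ (Nat.le_mul_of_pos_right _ hfpos)
    _ = V.index := by rw [hfund, hG]

/-- **The primes containing `p`, for a unique place above `p`.**  If `𝓞_K` has only one finite place `v` containing `p`
(e.g. `K = ℚ`), then the primes of `𝓞_L` containing `p` (`L/K` an extension of number fields) all lie over `v`, so their
number is at most `#(v.primesOver 𝓞_L)`. [cite: NeukirchANT1999, Ch. I §9 (9.9)] -/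
theorem natCard_primes_mem_le_ncard_primesOver (L : Type) [Field L] [NumberField L] [Algebra K L]
    {v : HeightOneSpectrum (𝓞 K)}
    (huniq : ∀ w : HeightOneSpectrum (𝓞 K), ((p : ℕ) : 𝓞 K) ∈ w.asIdeal → w = v) :
    Nat.card {w : HeightOneSpectrum (𝓞 L) // ((p : ℕ) : 𝓞 L) ∈ w.asIdeal} ≤ (v.asIdeal.primesOver (𝓞 L)).ncard := by
  have hpr : p.Prime := Fact.out
  haveI := v.isPrime
  have hfin := IsDedekindDomain.primesOver_finite v.asIdeal (𝓞 L)
  rw [← Nat.card_coe_set_eq]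
  haveI := hfin.to_subtype
  refine Nat.card_le_card_of_injective
    (fun w => (⟨w.1.asIdeal, ⟨w.1.isPrime, ?_⟩⟩ : v.asIdeal.primesOver (𝓞 L))) ?_
  · haveI := w.1.isPrime
    haveI : (w.1.asIdeal.under (𝓞 K)).IsPrime := Ideal.IsPrime.under (𝓞 K) w.1.asIdeal
    have hmemK : ((p : ℕ) : 𝓞 K) ∈ w.1.asIdeal.under (𝓞 K) := by
      rw [Ideal.under_def, Ideal.mem_comap, map_natCast]; exact w.2
    have hne : w.1.asIdeal.under (𝓞 K) ≠ ⊥ := by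
      intro h0
      rw [h0, Ideal.mem_bot] at hmemK
      exact hpr.ne_zero (by exact_mod_cast hmemK)
    have hw : (⟨w.1.asIdeal.under (𝓞 K), inferInstance, hne⟩ : HeightOneSpectrum (𝓞 K)) = v :=
      huniq _ hmemK
    constructor
    have h := congrArg HeightOneSpectrum.asIdeal hw
    exact h.symm
  · intro w w' hww
    have h := congrArg (fun x : v.asIdeal.primesOver (𝓞 L) => (x : Ideal (𝓞 L))) hww
    exact Subtype.ext (HeightOneSpectrum.ext h)

/-! ## §3 The class number of `K₀ ⊔ K_n` is `e_n(κ|_{K₀})` -/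

/-- **`ord_p #Cl(𝓞 (K₀ ⊔ K_n)) = e_n(κ|_{K₀})`** for a subgroup `N ≤ Γ_K` with fixed field `K₀ = K̄^N` (a number field)
on which `κ` restricts to a `ℤ_p`-extension (i.e. `κ ∘ res` is onto): the `n`-th layer of `κ|_{K₀}` is `K`-isomorphic to
the compositum `K₀ ⊔ K_n ⊆ K̄` (`ClassicalMuVanishesSubextension.nonempty_algEquiv_layer_restrict_fieldRange_sup_layer`), and
class groups are invariant under ring isomorphisms. [cite: Washington1997, §13.1] -/
theorem padicValNat_card_classGroup_eq_classNumberPExp (κ : ZpExtension K p)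
    (N : Subgroup (absoluteGaloisGroup K))
    [NumberField (fixedField N : IntermediateField K (AlgebraicClosure K))]
    (h : Function.Surjective (κ.toContinuousMonoidHom.comp
      (absGaloisRestrict K (fixedField N : IntermediateField K (AlgebraicClosure K)))))
    (n : ℕ) [NumberField (↥((fixedField N : IntermediateField K (AlgebraicClosure K)) ⊔ κ.layer n))] :
    padicValNat p (Nat.card (ClassGroup (𝓞 ↥((fixedField N : IntermediateField K (AlgebraicClosure K)) ⊔
        κ.layer n)))) =
      classNumberPExp (κ.restrict (fixedField N : IntermediateField K (AlgebraicClosure K)) h) n := by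
  set K₀ : IntermediateField K (AlgebraicClosure K) := fixedField N with hK₀
  obtain ⟨e⟩ := nonempty_algEquiv_layer_restrict_fieldRange_sup_layer κ K₀ h K₀.val n
  have hval : K₀.val.fieldRange ⊔ κ.layer n = K₀ ⊔ κ.layer n := by rw [IntermediateField.fieldRange_val]
  let e' : ↥((κ.restrict K₀ h).layer n) ≃ₐ[K] ↥(K₀ ⊔ κ.layer n) := e.trans (IntermediateField.equivOfEq hval)
  rw [classNumberPExp_def]
  congr 1
  exact Nat.card_congr (ClassGroup.mulEquiv (RingOfIntegers.mapRingEquiv e'.toRingEquiv)).toEquiv.symm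

end Literature.NumberTheory.IwasawaTheory.CyclotomicTowerPrimesAboveBound

end
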